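import Mathlib
import Summits.Ventures.HodgeRepro.Tier4.Common.KTypeSpace
import Summits.Ventures.HodgeRepro.Tier4.Common.SettingOfData
import Summits.Ventures.HodgeRepro.Tier4.Line1.SpectralOfRTF
import Summits.Ventures.HodgeRepro.Tier4.Line1.IrreducibleSubspace
import Summits.Ventures.HodgeRepro.Tier4.Line1.KernelNondegenerate
import Summits.Ventures.HodgeRepro.Tier4.Line1.LocallyCompactGA
import Summits.Ventures.HodgeRepro.Tier4.Line1.SecondCountableGA
import Summits.Ventures.HodgeRepro.Tier4.Line1.L2InfiniteGA
import Summits.Ventures.HodgeRepro.Tier4.Line1.MaximalFamily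
import Summits.Ventures.HodgeRepro.Tier4.Line4.W4SpectralBridge
import Summits.Ventures.HodgeRepro.Tier4.Line4.W3Reduction
import Summits.Ventures.HodgeRepro.Tier4.Line4.W3Reduction2
import Summits.Ventures.HodgeRepro.Tier4.Line4.AdaptedONBAdapted3
import Summits.Ventures.HodgeRepro.Tier4.Line4.AdaptedONBConj
import Summits.Ventures.HodgeRepro.Tier4.Line4.ConjSpanLemmas

/-!
# Tier4/Line4/W3OfAdapted2 — the wall W3″ of LINE L4 from BASIS-FREE per-constituent data, with the finiteness clause
asked of the IRREDUCIBLE constituents only (crit-1 g4 F-L4-hfin, S13667)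

Blind re-derivation cell `pub-hodge-repro`, Tier 4 «prove the step» (README §9–§10), seat t4-L4-p1 (prover, LINE L4,
gen 3; cut of record S13520; findings S13578 (2), S13597 (2)).  Tree path
`lean/Summits/Ventures/HodgeRepro/Tier4/Line4/W3OfAdapted2.lean`.  Over a GENERIC plane `W` on typer-2's
`Setting.ofAdelicData` (the skeleton instantiates `W := seesawPlane …`, `w₀ := w₀ d`).

ERRATUM (crit-1 g4 F-L4-hfin, S13667): `W3OfAdapted.mixed_two_torus_W3_of_adapted` asks its finiteness clause `hfin` of
EVERY invariant subspace; the maximal one (all continuous invariant functions on the cocompact quotient) has an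
infinite-dimensional `K`-type space, so that clause has no genuine instance.  `mixed_two_torus_W3_of_adapted'` below
asks it of the non-zero IRREDUCIBLE constituents only (Harish-Chandra admissibility of irreducible unitary
representations — print-facing, true), on `AdaptedONBAdapted3.exists_adaptedONB_adapted''`.  Same proof otherwise.

WHAT IS PROVED.  `mixed_two_torus_W3_of_adapted'` — W3″'s conclusion (verbatim) from data that mention NO orthonormal basis,
quantified over the non-zero irreducible invariant subspaces `U` of the setting (`IsIrrNonzero`; the ONB's
constituent is the CONJUGATE of `U`, L1's kernel expansion conjugating the `T`-slot):
(a) `hfin` — the `K`-type space of every non-zero irreducible constituent is finite-dimensional (Harish-Chandra);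
(b) `ha`/`hb` — `R(f̄₁)`, `R(f₂ˇ)` act by a scalar on the conjugate of the `K`-type space of every constituent;
`hvan` — `R(f̄₁)` kills the conjugate of every vector of a constituent orthogonal to its `K`-type space
(within-constituent vanishing only: a bi-`(τ,K)`-finite test function); `hadm` — a constituent on whose `K`-type
space `R(f̄₁)` acts by a non-zero scalar is admissible (the admissible-projector content of the isolation);
(c) `hJ : Jc(f₁ ⋆ f₂) ≠ 0`.
Proof: `AdaptedONBAdapted3.exists_adaptedONB_adapted''` with `Wfd V := conj '' (K-type space of span (conj '' V))`
gives the adapted ONB with a `(τ,K)`-block in every constituent; the per-block scalars and the admissibility are read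
off the basis-free data on `U := conj '' τ m`; L1-p5's `W3Reduction2.mixed_two_torus_W3_of_spectral_data''` (p681726: the
repaired reduction without its two vacuous binders, S13597 (2) / S13599) finishes.  No block-killing pair, no finite-rank device, no
conjugation-closedness.  What stays print-facing: (a), (b) and (c) themselves.

Nothing here says anything about the status of the Hodge conjecture for CM abelian varieties, which is NOT proved
(HC_CM is NOT proved by anyone in this repository).
-/

set_option autoImplicit false

noncomputable section

namespace Summit.Ventures.HodgeRepro.Tier4.Line4

open Summit.Ventures.HodgeRepro.Tier4.Common Summit.Ventures.HodgeRepro.Tier4.Line1 MeasureTheory NumberField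
open scoped ComplexConjugate

section Constituents

variable {k : Type} [Field k] [NumberField k] (W : PlaneData k) [MeasurableSpace (GA W)] [BorelSpace (GA W)]
  (R : RTFData W) (μ : Measure (GA W)) [μ.IsHaarMeasure] [R.μT.IsHaarMeasure] [R.μT'.IsHaarMeasure]
  (DG : Set (GA W)) (fdG : IsFundamentalDomain (rationalPoints W) DG μ) (compG : IsCompact (closure DG))
  (compT : IsCompact (closure R.DT)) (compT' : IsCompact (closure R.DT'))

/-- **W3″ FROM BASIS-FREE PER-CONSTITUENT DATA** (the wall's residual after (R), with no orthonormal basis in it):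
quantified over the non-zero irreducible invariant subspaces `U` of the setting (the constituents; the ONB's
constituent is `conj '' U`): (a) `hfin` — every non-zero irreducible constituent has a finite-dimensional `K`-type
space at the level `K`; (b) `ha`/`hb` — `R(f̄₁)`, `R(f₂ˇ)` act by a scalar on the conjugate of the `K`-type space of every
constituent, `hvan` — `R(f̄₁)` kills the conjugate of every vector of a constituent orthogonal to its `K`-type space,
`hadm` — a constituent on whose `K`-type space `R(f̄₁)` acts by a non-zero scalar is admissible; (c) `Jc(f₁ ⋆ f₂) ≠ 0`.
Then some admissible `V₀` carries, on its `K`-type space, a Riesz vector of the `T′`-period with a non-zero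
`T`-period — the conclusion of the wall `mixed_two_torus_W3` verbatim over a generic plane. -/
theorem mixed_two_torus_W3_of_adapted' (hc : Continuous R.chi) (hu : ∀ a, ‖R.chi a‖ = 1)
    (hc' : Continuous R.chi') (hunit' : ∀ t, ‖R.chi' t‖ = 1)
    (q : QuadData k) (g g' : Matrix (Fin 4) (Fin 4) k) (w₀ : InfinitePlace k)
    (eP eM eP' eM' : InfinitePlace k → ℤ)
    (K : Subgroup (GA W)) (hK : IsCompactOpenIn W (finitePart W) K)
    (hfin : ∀ U : Set (GA W → ℂ), (Setting.ofAdelicData W R μ DG fdG compG compT compT').IsIrrNonzero U →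
      FiniteDimensional ℂ (kTypeSpace W q g g' eP eM eP' eM' K (Submodule.span ℂ U)))
    {f₁ f₂ : GA W → ℂ} (h₁ : IsTestFn W f₁) (h₂ : IsTestFn W f₂)
    (ha : ∀ U : Set (GA W → ℂ), (Setting.ofAdelicData W R μ DG fdG compG compT compT').IsIrrNonzero U →
      ∃ a : ℂ, ∀ ψ ∈ kTypeSpace W q g g' eP eM eP' eM' K (Submodule.span ℂ U),
        rightRegular W μ (RTF.cj f₁) (fun x => conj (ψ x)) = fun x => a * conj (ψ x))
    (hb : ∀ U : Set (GA W → ℂ), (Setting.ofAdelicData W R μ DG fdG compG compT compT').IsIrrNonzero U →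
      ∃ b : ℂ, ∀ ψ ∈ kTypeSpace W q g g' eP eM eP' eM' K (Submodule.span ℂ U),
        rightRegular W μ (RTF.refl f₂) (fun x => conj (ψ x)) = fun x => b * conj (ψ x))
    (hvan : ∀ U : Set (GA W → ℂ), (Setting.ofAdelicData W R μ DG fdG compG compT compT').IsIrrNonzero U →
      ∀ ψ ∈ U, (∀ w ∈ kTypeSpace W q g g' eP eM eP' eM' K (Submodule.span ℂ U),
        (Setting.ofAdelicData W R μ DG fdG compG compT compT').inner ψ w = 0) →
        rightRegular W μ (RTF.cj f₁) (fun x => conj (ψ x)) = fun _ => 0)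
    (hadm : ∀ U : Set (GA W → ℂ), (Setting.ofAdelicData W R μ DG fdG compG compT compT').IsIrrNonzero U →
      ∀ a : ℂ, a ≠ 0 →
      (∃ ψ ∈ kTypeSpace W q g g' eP eM eP' eM' K (Submodule.span ℂ U), ψ ≠ 0 ∧
        rightRegular W μ (RTF.cj f₁) (fun x => conj (ψ x)) = fun x => a * conj (ψ x)) →
      IsAdmissibleS W (Setting.ofAdelicData W R μ DG fdG compG compT compT') q g g' w₀ eP eM eP' eM'
        (Submodule.span ℂ U))
    (hJ : R.Jc ((Setting.ofAdelicData W R μ DG fdG compG compT compT').conv f₁ f₂) ≠ 0) :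
    ∃ V₀ : Submodule ℂ (GA W → ℂ),
      IsAdmissibleS W (Setting.ofAdelicData W R μ DG fdG compG compT compT') q g g' w₀ eP eM eP' eM' V₀ ∧
      ∃ K₀ : Subgroup (GA W), IsCompactOpenIn W (finitePart W) K₀ ∧
        FiniteDimensional ℂ (kTypeSpace W q g g' eP eM eP' eM' K₀ V₀) ∧
        ∃ f : GA W → ℂ, IsRieszVectorOn R μ DG (kTypeSpace W q g g' eP eM eP' eM' K₀ V₀) f ∧
          periodLin W R.μT R.DT R.chi (restrictTo W (torusT W) f) ≠ 0 := by
  classical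
  set S := Setting.ofAdelicData W R μ DG fdG compG compT compT' with hS
  haveI := locallyCompact_GA W
  haveI := secondCountable_GA W
  -- the functorial `(τ,K)`-part of a constituent: the conjugate of the `K`-type space of its conjugate
  let Wk : Set (GA W → ℂ) → Submodule ℂ (GA W → ℂ) := fun V =>
    kTypeSpace W q g g' eP eM eP' eM' K (Submodule.span ℂ ((fun ψ : GA W → ℂ => fun x => conj (ψ x)) '' V))
  let Wfd : Set (GA W → ℂ) → Submodule ℂ (GA W → ℂ) := fun V =>
    Submodule.span ℂ ((fun ψ : GA W → ℂ => fun x => conj (ψ x)) '' (Wk V : Set (GA W → ℂ)))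
  have hW : ∀ V : Set (GA W → ℂ), S.IsInvariantSubspace V → S.IsIrreducible V → (0 : GA W → ℂ) ∈ V →
      (Wfd V : Set (GA W → ℂ)) ⊆ V ∧ FiniteDimensional ℂ (Wfd V) := by
    intro V hV hVirr h0
    have hVc : S.IsInvariantSubspace ((fun ψ : GA W → ℂ => fun x => conj (ψ x)) '' V) :=
      isInvariantSubspace_conj S hV
    have hVne : V.Nonempty := ⟨0, h0⟩
    have hspanV : (Submodule.span ℂ V : Set (GA W → ℂ)) = V := coe_span_eq_of_isInvariantSubspace S hV hVne
    have hspanVc : (Submodule.span ℂ ((fun ψ : GA W → ℂ => fun x => conj (ψ x)) '' V) : Set (GA W → ℂ)) =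
        (fun ψ : GA W → ℂ => fun x => conj (ψ x)) '' V :=
      coe_span_eq_of_isInvariantSubspace S hVc (hVne.image _)
    refine ⟨?_, ?_⟩
    · have hsub : (fun ψ : GA W → ℂ => fun x => conj (ψ x)) '' (Wk V : Set (GA W → ℂ)) ⊆ V := by
        rintro _ ⟨w, hw, rfl⟩
        have hw' : w ∈ (fun ψ : GA W → ℂ => fun x => conj (ψ x)) '' V := by
          rw [← hspanVc]
          exact kTypeSpace_le W q g g' eP eM eP' eM' K _ hw
        obtain ⟨v, hv, rfl⟩ := hw'
        show (fun x => conj (conj (v x))) ∈ V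
        have e : (fun x => conj (conj (v x))) = v := by
          funext x
          simp
        rw [e]
        exact hv
      intro u hu
      rw [← hspanV]
      exact Submodule.span_mono hsub hu
    · -- finiteness: either `V` is a non-zero constituent (Harish-Chandra, `hfin`) or `V ⊆ {0}`
      by_cases hne : ∃ ψ ∈ V, ∃ x, ψ x ≠ 0
      · haveI : FiniteDimensional ℂ (Wk V) := hfin _ (isIrrNonzero_conj S ⟨hV, hVirr, hne⟩)
        exact finiteDimensional_span_conj_image (Wk V)
      · have hVzero : V = {0} := by
          apply Set.Subset.antisymm
          · intro ψ hψ
            rw [Set.mem_singleton_iff]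
            funext x
            by_contra hx
            exact hne ⟨ψ, hψ, x, hx⟩
          · intro ψ hψ
            rw [Set.mem_singleton_iff] at hψ
            rw [hψ]
            exact h0
        have hWk : Wk V = ⊥ := by
          apply le_bot_iff.1
          refine (kTypeSpace_le W q g g' eP eM eP' eM' K _).trans ?_
          rw [Submodule.span_le]
          rintro _ ⟨ψ, hψ, rfl⟩
          rw [hVzero, Set.mem_singleton_iff] at hψ
          rw [hψ]
          simp only [SetLike.mem_coe, Submodule.mem_bot]
          funext x
          simp
        have : Wfd V = ⊥ := by
          show Submodule.span ℂ ((fun ψ : GA W → ℂ => fun x => conj (ψ x)) '' (Wk V : Set (GA W → ℂ))) = ⊥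
          rw [hWk, Submodule.span_eq_bot]
          rintro _ ⟨ψ, hψ, rfl⟩
          rw [SetLike.mem_coe, Submodule.mem_bot] at hψ
          rw [hψ]
          funext x
          simp
        rw [this]
        infer_instance
  -- the adapted ONB with a `(τ,K)`-block in every constituent
  obtain ⟨τ, φ, n, hB, F, -, hF, hspan⟩ := exists_adaptedONB_adapted'' S
    (not_finiteDimensional_L2_DG W μ fdG compG)
    (fun V' hV' hcl hne' => S.exists_irreducible_invariant_subspace_of_nondegenerate V' hV' hcl hne'
      S.kernelOp_nondegenerate) Wfd hW
  -- the constituents of the reduction: the conjugates of the ONB's constituents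
  let Vm : ℕ → Submodule ℂ (GA W → ℂ) := fun m =>
    Submodule.span ℂ ((fun ψ : GA W → ℂ => fun x => conj (ψ x)) '' τ m)
  have hWkV : ∀ m, Wk (τ m) = kTypeSpace W q g g' eP eM eP' eM' K (Vm m) := fun m => rfl
  -- the conjugate blocks span the `K`-type spaces
  have hspan' : ∀ m, Submodule.span ℂ ((fun j => fun x => conj (φ j x)) '' (F m : Set ℕ)) =
      kTypeSpace W q g g' eP eM eP' eM' K (Vm m) := by
    intro m
    have e1 : (fun j => fun x => conj (φ j x)) '' (F m : Set ℕ) =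
        (fun ψ : GA W → ℂ => fun x => conj (ψ x)) '' (φ '' (F m : Set ℕ)) := by
      rw [Set.image_image]
    rw [e1, ← span_conj_image_span, hspan m]
    show Submodule.span ℂ ((fun ψ : GA W → ℂ => fun x => conj (ψ x)) '' (Wfd (τ m) : Set (GA W → ℂ))) = _
    rw [span_conj_image_span, conj_image_conj_image, Submodule.span_eq]
  -- basis vectors are non-zero and continuous; a block-carrying constituent is non-zero
  have hφc : ∀ j, Continuous (φ j) := fun j => (hB.inv (n j)).cont _ (hB.mem j)
  have hφcc : ∀ j, Continuous (fun x => conj (φ j x)) := fun j => Complex.continuous_conj.comp (hφc j)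
  have hφne : ∀ j, φ j ≠ 0 := by
    intro j h
    have h1 := hB.orth j j
    rw [if_pos rfl, h, S.inner_fun_zero_left] at h1
    exact zero_ne_one h1
  have hτne : ∀ j, S.IsIrrNonzero (τ (n j)) := by
    intro j
    refine ⟨hB.inv (n j), hB.irred (n j), φ j, hB.mem j, ?_⟩
    obtain ⟨x, hx⟩ := Function.ne_iff.1 (hφne j)
    exact ⟨x, hx⟩
  have hUne : ∀ j, S.IsIrrNonzero ((fun ψ : GA W → ℂ => fun x => conj (ψ x)) '' τ (n j)) :=
    fun j => isIrrNonzero_conj S (hτne j)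
  -- the conjugate of a block vector lies in the `K`-type space of the constituent
  have hmemK : ∀ m, ∀ j ∈ F m, (fun x => conj (φ j x)) ∈ kTypeSpace W q g g' eP eM eP' eM' K (Vm m) := by
    intro m j hj
    rw [← hspan' m]
    exact Submodule.subset_span ⟨j, Finset.mem_coe.2 hj, rfl⟩
  -- the per-constituent scalars
  let a' : ℕ → ℂ := fun m =>
    if h : S.IsIrrNonzero ((fun ψ : GA W → ℂ => fun x => conj (ψ x)) '' τ m) ∧ (F m).Nonempty then
      Classical.choose (ha _ h.1) else 0
  let b' : ℕ → ℂ := fun m =>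
    if h : S.IsIrrNonzero ((fun ψ : GA W → ℂ => fun x => conj (ψ x)) '' τ m) ∧ (F m).Nonempty then
      Classical.choose (hb _ h.1) else 0
  have ha'_spec : ∀ m, (h : S.IsIrrNonzero ((fun ψ : GA W → ℂ => fun x => conj (ψ x)) '' τ m) ∧ (F m).Nonempty) →
      ∀ ψ ∈ kTypeSpace W q g g' eP eM eP' eM' K (Vm m),
        rightRegular W μ (RTF.cj f₁) (fun x => conj (ψ x)) = fun x => a' m * conj (ψ x) := by
    intro m h ψ hψ
    have e : a' m = Classical.choose (ha _ h.1) := by simp only [a', dif_pos h]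
    rw [e]
    exact Classical.choose_spec (ha _ h.1) ψ hψ
  have hb'_spec : ∀ m, (h : S.IsIrrNonzero ((fun ψ : GA W → ℂ => fun x => conj (ψ x)) '' τ m) ∧ (F m).Nonempty) →
      ∀ ψ ∈ kTypeSpace W q g g' eP eM eP' eM' K (Vm m),
        rightRegular W μ (RTF.refl f₂) (fun x => conj (ψ x)) = fun x => b' m * conj (ψ x) := by
    intro m h ψ hψ
    have e : b' m = Classical.choose (hb _ h.1) := by simp only [b', dif_pos h]
    rw [e]
    exact Classical.choose_spec (hb _ h.1) ψ hψ
  have ha'_zero : ∀ m, ¬ (S.IsIrrNonzero ((fun ψ : GA W → ℂ => fun x => conj (ψ x)) '' τ m) ∧ (F m).Nonempty) →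
      a' m = 0 := by
    intro m h
    simp only [a', dif_neg h]
  have hconjconj : ∀ ψ : GA W → ℂ, (fun x => conj (conj (ψ x))) = ψ := by
    intro ψ
    funext x
    simp
  -- the eigen-relations on the blocks
  have ha' : ∀ m, ∀ j ∈ F m, rightRegular W μ (RTF.cj f₁) (φ j) = fun x => a' m * φ j x := by
    intro m j hj
    have hm : n j = m := hF m j hj
    have hU : S.IsIrrNonzero ((fun ψ : GA W → ℂ => fun x => conj (ψ x)) '' τ m) := hm ▸ hUne j
    have := ha'_spec m ⟨hU, ⟨j, hj⟩⟩ _ (hmemK m j hj)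
    simp only [Complex.conj_conj] at this
    exact this
  have hb' : ∀ m, ∀ j ∈ F m, rightRegular W μ (RTF.refl f₂) (φ j) = fun x => b' m * φ j x := by
    intro m j hj
    have hm : n j = m := hF m j hj
    have hU : S.IsIrrNonzero ((fun ψ : GA W → ℂ => fun x => conj (ψ x)) '' τ m) := hm ▸ hUne j
    have := hb'_spec m ⟨hU, ⟨j, hj⟩⟩ _ (hmemK m j hj)
    simp only [Complex.conj_conj] at this
    exact this
  -- admissibility of the constituents carrying a non-zero scalar on a non-empty block
  have hadm' : ∀ m, a' m ≠ 0 → IsAdmissibleS W S q g g' w₀ eP eM eP' eM' (Vm m) := by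
    intro m hane
    have hcond : S.IsIrrNonzero ((fun ψ : GA W → ℂ => fun x => conj (ψ x)) '' τ m) ∧ (F m).Nonempty := by
      by_contra h
      exact hane (ha'_zero m h)
    obtain ⟨j, hj⟩ := hcond.2
    have hm : n j = m := hF m j hj
    have hU : S.IsIrrNonzero ((fun ψ : GA W → ℂ => fun x => conj (ψ x)) '' τ m) := hm ▸ hUne j
    refine hadm _ hU (a' m) hane ⟨fun x => conj (φ j x), hmemK m j hj, ?_, ?_⟩
    · intro h
      apply hφne j
      funext x
      have hx := congrFun h x
      simp only [Pi.zero_apply] at hx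
      exact (map_eq_zero (starRingEnd ℂ)).1 hx
    · simp only [Complex.conj_conj]
      exact ha' m j hj
  -- the vanishing within each constituent
  have hvan' : ∀ j, j ∉ F (n j) → rightRegular W μ (RTF.cj f₁) (φ j) = fun _ => 0 := by
    intro j hj
    have hU := hUne j
    have hψ : (fun x => conj (φ j x)) ∈ (fun ψ : GA W → ℂ => fun x => conj (ψ x)) '' τ (n j) :=
      ⟨φ j, hB.mem j, rfl⟩
    have key : ∀ w ∈ kTypeSpace W q g g' eP eM eP' eM' K (Vm (n j)), S.inner (fun x => conj (φ j x)) w = 0 := by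
      intro w hw
      rw [← hspan' (n j)] at hw
      obtain ⟨hwc, hwo⟩ := inner_eq_zero_of_mem_span_conjBlock W R μ DG fdG compG compT compT' hB (F (n j)) hj hw
      rw [S.inner_conj (S.memLp_restrict_of_continuous hwc) (S.memLp_restrict_of_continuous (hφcc j)), hwo,
        map_zero]
    have := hvan _ hU _ hψ key
    simp only [Complex.conj_conj] at this
    exact this
  exact mixed_two_torus_W3_of_spectral_data'' W R μ DG fdG compG compT compT' hc hu hc' hunit' q g g' w₀ eP eM eP' eM'
    Vm K hK hB F hF hspan' h₁ h₂ a' b' hadm' ha' hb' hvan' hJ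

end Constituents

end Summit.Ventures.HodgeRepro.Tier4.Line4

end
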